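import Summits.Ventures.HodgeRepro.Tier3BranchNonvanishing
import Summits.Ventures.HodgeRepro.Tier4.LitMuInvariant

/-!
# LitMuInvariantChain — chain A of route/TIER3.md §6 on the kernel, from the PRINTED inputs as hypotheses

Blind re-derivation cell `pub-hodge-repro`, Tier-4 literature seat `t4-lit-4` (gen 0).  Target tree path
`lean/Summits/Ventures/HodgeRepro/Tier4/LitMuInvariantChain.lean`.  Imports: the Tier-3 kernel file
`Tier3BranchNonvanishing` (t3-p3; the four-line pinning from `G j ≠ 0` per line) and `Tier4/LitMuInvariant`
(this seat; Hsieh 2014 Theorem A and Burungale–Hida 2017 Theorem 1.2 as named Props over their data).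

WHAT IS PROVED (Mathlib + the two imports; no published theorem is proved): the composition
«Theorem A (χ_j) ∧ Theorem 1.2 (λ_j = χ_j) for each line j ⇒ the four 𝔭-line branch elements `G j` are ≠ 0 ⇒
(Tier-3 kernel) the four-line pinning: infinitely many `ν ∈ Ξ` with `L j ν ≠ 0 ∧ ε j ν = 1` for all four lines, and
N2 on them» — TIER3.md §6 chain A, steps (2)–(4), with EVERY analytic input a displayed hypothesis:

* `hH j : Hsieh2014_ThmA (DH j)`, `hB j : BurungaleHida2017_Thm1_2 (DB j)` — the two printed theorems, per line;
* `hDH j`, `hDB j` — their printed hypotheses, per line (p > 2, (ord), the p-ordinary type, χ_j of infinity type kΣ with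
  k ≥ 1, prime-to-p conductor, self-dual, root number +1, p ∤ D_F; p odd unramified in F, λ_j arithmetic of
  prime-to-p conductor);
* `hlink j : muInv (DB j).Lminus = muInv (DH j).branch` — the anticyclotomic measure of BH17 is Hsieh's branch
  measure (the same object, read in the two papers' notations);
* `hGμ j : muInv (G j) = muInv (DB j).LminusP` — the kernel's branch element `G j ∈ A⟦T⟧` is the 𝔭-line projection
  `L⁻_{Σ,λ_j,𝔭} ∈ A⟦Γ⁻_𝔭⟧ ≅ A⟦T⟧` (`deg 𝔭 = 1`; for `(DB j).VarP = Unit` the two are definitionally the same power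
  series and this is `rfl`);
* `hloc j` — every local component `χ_{j,v}` at `v | 𝔠_j⁻` takes a value `≠ 1` (`χ_{j,v}` ramified), so that
  Hsieh's `μ_p(χ_{j,v}) < ∞`;
* the kernel's own hypotheses: the interpolation formula `hL` with its non-zero factors `hu` (Hsieh 2014 Prop 4.9 /
  HT93 Thm II read at `χ_j ν`, as in `Tier3PinningGlue`), the root-of-unity dictionary `ζ`, `hζ`, `hev`, and the sign
  cofiniteness `hε`.

HONESTY.  Nothing here asserts that the hypotheses hold for the route's four characters; in particular (α′) of
TIER3.md §3 R-B covers the lines with `κ_j = 0` only (Hsieh's branch characters have infinity type `kΣ`), and the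
hypotheses of both theorems are exactly those printed (rows I-t4-lit-4-1 / -4).  Nothing here says anything about the
status of the Hodge conjecture for CM abelian varieties, which is NOT proved.
-/

set_option autoImplicit false

namespace Summit.Ventures.HodgeRepro.Tier4.Lit.MuInvariant

open PowerSeries Summit.Ventures.HodgeRepro.T3.R2Pinning

variable {A : Type*} [CommRing A] [IsDomain A] [IsDiscreteValuationRing A]
  [IsAdicComplete (IsLocalRing.maximalIdeal A) A] [UniformSpace A] [IsUniformAddGroup A]
  [IsTopologicalRing A]
variable {B : Type*} [CommRing B] [IsDomain B] [UniformSpace B] [IsUniformAddGroup B] [T2Space B]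
  [CompleteSpace B] [IsTopologicalRing B] [IsLinearTopology B B] [Algebra A B] [ContinuousSMul A B]
variable {Ξ : Type*}

omit [IsAdicComplete (IsLocalRing.maximalIdeal A) A] [UniformSpace A] [IsUniformAddGroup A]
  [IsTopologicalRing A] in
/-- **Chain A, steps (2)–(3), per line, with the kernel's branch element**: `G ≠ 0` from the two printed theorems
as hypotheses (`LminusP_ne_zero_of_chainA`) and the identification `muInv G = muInv L⁻_{Σ,λ,𝔭}`. -/
theorem branch_ne_zero_of_chainA {DH : HsiehData A} {DB : BHData A} (hH : Hsieh2014_ThmA DH)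
    (hB : BurungaleHida2017_Thm1_2 DB) (hDH : DH.Hypotheses) (hDB : DB.Hypotheses)
    (hlink : muInv DB.Lminus = muInv DH.branch)
    (hloc : ∀ v ∈ DH.badPlaces, ∃ x : DH.Kv v, DH.chiLocal v x ≠ 1) (G : PowerSeries A)
    (hGμ : muInv G = muInv DB.LminusP) : G ≠ 0 := by
  rw [← muInv_ne_top_iff, hGμ, muInv_ne_top_iff]
  exact LminusP_ne_zero_of_chainA hH hB hDH hDB hlink hloc

/-- **TIER3.md §6 chain A on the kernel, steps (2)–(4)**: the four-line pinning of `Tier3BranchNonvanishing`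
(`four_line_pinning_of_branch_ne_zero`) with the per-line input `G j ≠ 0` DERIVED from Hsieh 2014 Theorem A and
Burungale–Hida 2017 Theorem 1.2, both taken as hypotheses for each line's datum. -/
theorem four_line_pinning_of_chainA [Infinite Ξ] [CommGroup Ξ]
    (hinj : Function.Injective (algebraMap A B))
    (ζ : Ξ → B) (hζ : Function.Injective ζ) (hev : ∀ ν, HasEval (ζ ν - 1)) (G : Fin 4 → PowerSeries A)
    (L u : Fin 4 → Ξ → B) (hu : ∀ j ν, u j ν ≠ 0) (hL : ∀ j ν, L j ν = u j ν * aeval (hev ν) (G j))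
    (DH : Fin 4 → HsiehData A) (DB : Fin 4 → BHData A)
    (hH : ∀ j, Hsieh2014_ThmA (DH j)) (hB : ∀ j, BurungaleHida2017_Thm1_2 (DB j))
    (hDH : ∀ j, (DH j).Hypotheses) (hDB : ∀ j, (DB j).Hypotheses)
    (hlink : ∀ j, muInv (DB j).Lminus = muInv (DH j).branch)
    (hloc : ∀ j, ∀ v ∈ (DH j).badPlaces, ∃ x : (DH j).Kv v, (DH j).chiLocal v x ≠ 1)
    (hGμ : ∀ j, muInv (G j) = muInv (DB j).LminusP)
    (ε : Fin 4 → Ξ → ℤˣ) (hε : ∀ j, {ν | ε j ν ≠ 1}.Finite) :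
    {ν : Ξ | ∀ j, L j ν ≠ 0 ∧ ε j ν = 1}.Infinite ∧
      ∀ ν ∈ {ν : Ξ | ∀ j, L j ν ≠ 0 ∧ ε j ν = 1}, ∀ η : Fin 4 → Ξ, (∀ j, η j = ν) →
        η 0 * η 1 = η 2 * η 3 :=
  four_line_pinning_of_branch_ne_zero (B := B) hinj ζ hζ hev G L u hu hL
    (fun j => branch_ne_zero_of_chainA (hH j) (hB j) (hDH j) (hDB j) (hlink j) (hloc j) (G j) (hGμ j)) ε hε

end Summit.Ventures.HodgeRepro.Tier4.Lit.MuInvariant
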